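import Summits.ResolutionOfSingularities.ResolutionOfSingularities.Theorems.PurelyInseparableDim4TschirnhausFrame
import Summits.ResolutionOfSingularities.ResolutionOfSingularities.Theorems.PurelyInseparableDim4ResCone
import HarnessLib
import HarnessLib.Audit.Tags

/-!
# Purely inseparable four-folds — the LINEAR W-frame move on the residual cone (cell `res-dim4-pi`,
# K2(p) lane, brick (ii) FILE B3)

[OURS · counted 0 · cell `res-dim4-pi` · brick (ii) «Tschirnhaus / W-frame infrastructure»; this file
res-dim4-p-11 g2 (offer 22:49Z, «p-11 GO B3» res-dim4-p-1 g3 22:51Z).]  Nothing here proves K2(p),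
`NoIsolatedTrap p p` or resolution of singularities in dimension ≥ 4 / characteristic `p`.

E2-WINDOW (A2) chooses the W-frame by a LINEAR move of one free letter, `y_f = x_f − Σ_{i∈u} cᵢ xᵢ`; in the
tree this is `FrameChange.tsch f φ` with `φ = Σᵢ C(cᵢ)·xᵢ`, `c_f = 0` (homogeneous of degree `1`).  Unlike
the Tschirnhaus part (`ord₀ φ ≥ 2`, inert on the cone: `initialForm_tsch_of_two_le`), a linear move ACTS on
the residual cone `g = resForm s` and on its vertex; this file records how:

* §1 `isHomogeneous_tsch` (a degree-`1` move preserves homogeneity), `homogeneousComponent_tsch`,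
  **`initialForm_tsch_of_isHomogeneous_one`**: `in(tsch f φ F) = tsch f φ (in F)`; hence
  **`resForm_tschState_of_isHomogeneous_one`**: `resForm ⟨tsch f φ s.F, s.r, s.exc⟩ = tsch f φ (resForm s)`
  (`f` free: `r_f = 0`, `x^r ∣ F`).
* §2 the chain rule for the linear move `φ_c := Σᵢ C(cᵢ)·xᵢ` (`c_f = 0`): `pderiv_tsch_linear`,
  **`polarMap_tsch_linear`**: `D_w (tsch g) = tsch (D_{w⁺} g)` with `w⁺ := update w f (w_f + Σᵢ cᵢ wᵢ)`, so
  **`mem_additiveSubspace_tsch_linear_iff`**: `w ∈ A(tsch g) ↔ w⁺ ∈ A(g)` and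
  `finrank_additiveSubspace_tsch_linear` (`e_G` is frame-independent).
* §3 state level: `mem_resVertex_tschState_linear_iff`, **`finrank_resVertex_tschState_linear`**.

bears_on: LADDER-RESOLUTION:D157-DOOR2 (res-dim4-pi · K2(p) · (ii)).  Supports
stmt-ResolutionOfSingularities-16155 (helper).
-/

set_option linter.dupNamespace false -- mandated namespace of this single-conjunct summit

noncomputable section

namespace Summit.ResolutionOfSingularities.ResolutionOfSingularities.Theorems.PIDim4

namespace FrameChange

open MvPolynomial Finset
open Literature.AlgebraicGeometry.Resolution
open Literature.AlgebraicGeometry.Resolution.Hauser2010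
open Literature.AlgebraicGeometry.Resolution.HauserPerlega2019
open Literature.AlgebraicGeometry.Resolution.CentreBlowup
open PointBlowup (polarMap additiveSubspace)

variable {K : Type} [Field K] {f : Fin 4} {φ : MvPolynomial (Fin 4) K}

/-! ## 1. A degree-one move is a graded automorphism -/

/-- A degree-`1` move preserves homogeneity. [folklore] -/
theorem isHomogeneous_tsch (hφ1 : φ.IsHomogeneous 1) {F : MvPolynomial (Fin 4) K} {n : ℕ}
    (hF : F.IsHomogeneous n) : (tsch f φ F).IsHomogeneous n := by
  have h := hF.aeval (fun i => if i = f then X f + φ else X i) (n := 1) (fun i => by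
    by_cases hif : i = f
    · rw [if_pos hif]; exact (isHomogeneous_X K f).add hφ1
    · rw [if_neg hif]; exact isHomogeneous_X K i)
  rw [one_mul] at h
  exact h

/-- A homogeneous polynomial of degree `1` has no constant term. [folklore] -/
theorem constantCoeff_eq_zero_of_isHomogeneous_one (hφ1 : φ.IsHomogeneous 1) : constantCoeff φ = 0 := by
  exact hφ1.coeff_eq_zero (d := 0) (by rw [map_zero]; exact zero_ne_one)

/-- **A degree-`1` move commutes with taking homogeneous components.** [folklore] -/
theorem homogeneousComponent_tsch (hφ1 : φ.IsHomogeneous 1) (F : MvPolynomial (Fin 4) K) (n : ℕ) :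
    homogeneousComponent n (tsch f φ F) = tsch f φ (homogeneousComponent n F) := by
  classical
  conv_lhs => rw [← sum_homogeneousComponent (φ := F), map_sum, map_sum]
  rw [Finset.sum_eq_single n]
  · exact homogeneousComponent_eq_self (isHomogeneous_tsch hφ1 (homogeneousComponent_isHomogeneous n F))
  · intro m _ hmn
    rw [homogeneousComponent_of_mem (isHomogeneous_tsch hφ1 (homogeneousComponent_isHomogeneous m F)),
      if_neg (Ne.symm hmn)]
  · intro hn
    rw [Finset.mem_range, not_lt] at hn
    rw [homogeneousComponent_eq_zero n F (lt_of_lt_of_le (Nat.lt_succ_self _) hn), map_zero, map_zero]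

/-- **`in(tsch f φ F) = tsch f φ (in F)`** for a degree-`1` move not involving `x_f` in `φ`. [folklore] -/
theorem initialForm_tsch_of_isHomogeneous_one (hφ : f ∉ φ.vars) (hφ1 : φ.IsHomogeneous 1)
    (F : MvPolynomial (Fin 4) K) : initialForm (tsch f φ F) = tsch f φ (initialForm F) := by
  unfold initialForm
  rw [ordZero_tsch hφ (constantCoeff_eq_zero_of_isHomogeneous_one hφ1), homogeneousComponent_tsch hφ1]

/-- **The residual cone moves with the frame**: for a degree-`1` move of a FREE letter `f` (`r_f = 0`,
`f ∉ φ.vars`) of a presented state with `x^r ∣ F`, `resForm ⟨tsch f φ s.F, s.r, s.exc⟩ = tsch f φ (resForm s)`.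
[folklore] -/
theorem resForm_tschState_of_isHomogeneous_one (hφ : f ∉ φ.vars) (hφ1 : φ.IsHomogeneous 1) {s : State K}
    (hr0 : s.r f = 0) (hr : ∀ d ∈ s.F.support, s.r ≤ d) :
    ResCone.resForm (⟨tsch f φ s.F, s.r, s.exc⟩ : State K) = tsch f φ (ResCone.resForm s) := by
  classical
  unfold ResCone.resForm
  dsimp only
  rw [initialForm_tsch_of_isHomogeneous_one hφ hφ1, ← ResCone.monomial_mul_resForm hr, tsch_monomial_mul φ hr0,
    divMonomial_monomial_mul, divMonomial_monomial_mul]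

/-! ## 2. The chain rule for a linear move -/

section Linear

variable {c : Fin 4 → K}

/-- The linear datum `φ_c = Σᵢ C(cᵢ)·xᵢ` is homogeneous of degree `1`. [folklore] -/
theorem isHomogeneous_linear (c : Fin 4 → K) :
    (∑ i, C (c i) * X i : MvPolynomial (Fin 4) K).IsHomogeneous 1 :=
  IsHomogeneous.sum _ _ 1 fun i _ => (isHomogeneous_X K i).C_mul (c i)

/-- With `c_f = 0` the linear datum does not involve `x_f`. [folklore] -/
theorem not_mem_vars_linear (hc : c f = 0) : f ∉ (∑ i, C (c i) * X i : MvPolynomial (Fin 4) K).vars := by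
  classical
  intro h
  obtain ⟨i, _, hi⟩ := Finset.mem_biUnion.mp (MvPolynomial.vars_sum_subset _ _ h)
  have hi' := MvPolynomial.vars_mul _ _ hi
  rw [Finset.mem_union, MvPolynomial.vars_C] at hi'
  rcases hi' with hi' | hi'
  · exact Finset.notMem_empty _ hi'
  · by_cases hci : c i = 0
    · -- then `C (c i) * X i = 0`, no variables
      rw [hci, C_0, zero_mul, MvPolynomial.vars_0] at hi
      exact Finset.notMem_empty _ hi
    · rw [MvPolynomial.vars_X, Finset.mem_singleton] at hi'
      subst hi'
      exact hci hc

/-- `∂_k φ_c = c_k`. [folklore] -/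
theorem pderiv_linear (c : Fin 4 → K) (k : Fin 4) :
    pderiv k (∑ i, C (c i) * X i : MvPolynomial (Fin 4) K) = C (c k) := by
  classical
  rw [map_sum]
  simp_rw [pderiv_C_mul, pderiv_X]
  rw [Finset.sum_eq_single k]
  · rw [Pi.single_eq_same, mul_one]
  · intro i _ hik; rw [Pi.single_eq_of_ne hik, mul_zero]
  · intro h; exact absurd (Finset.mem_univ k) h

/-- **Chain rule for the linear move**: `∂_k (tsch f φ_c g) = tsch (∂_k g) + c_k · tsch (∂_f g)` (`c_f = 0`).
[cite: Humphreys1990, § 3.10 (chain rule)] -/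
theorem pderiv_tsch_linear (hc : c f = 0) (g : MvPolynomial (Fin 4) K) (k : Fin 4) :
    pderiv k (tsch f (∑ i, C (c i) * X i) g) =
      tsch f (∑ i, C (c i) * X i) (pderiv k g) + C (c k) * tsch f (∑ i, C (c i) * X i) (pderiv f g) := by
  classical
  rw [tsch, Literature.Algebra.Polynomial.JacobianCriterion.pderiv_aeval, ← tsch]
  -- split off the term `i = f`
  rw [← Finset.add_sum_erase _ _ (Finset.mem_univ f), if_pos rfl, map_add, pderiv_X, pderiv_linear]
  have hrest : ∑ i ∈ Finset.univ.erase f, tsch f (∑ i, C (c i) * X i) (pderiv i g) *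
      pderiv k (if i = f then X f + ∑ i, C (c i) * X i else X i) =
      if k = f then 0 else tsch f (∑ i, C (c i) * X i) (pderiv k g) := by
    have hterm : ∀ i ∈ Finset.univ.erase f, tsch f (∑ i, C (c i) * X i) (pderiv i g) *
        pderiv k (if i = f then X f + ∑ i, C (c i) * X i else X i) =
        if i = k then tsch f (∑ i, C (c i) * X i) (pderiv k g) else 0 := by
      intro i hi
      rw [if_neg (Finset.ne_of_mem_erase hi), pderiv_X]
      by_cases hik : i = k
      · subst hik; rw [Pi.single_eq_same, mul_one, if_pos rfl]
      · rw [Pi.single_eq_of_ne hik, mul_zero, if_neg hik]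
    rw [Finset.sum_congr rfl hterm, Finset.sum_ite_eq']
    by_cases hkf : k = f
    · subst hkf; rw [if_neg (Finset.notMem_erase k _), if_pos rfl]
    · rw [if_pos (Finset.mem_erase.mpr ⟨hkf, Finset.mem_univ k⟩), if_neg hkf]
  rw [hrest]
  by_cases hkf : k = f
  · subst hkf
    rw [Pi.single_eq_same, hc, C_0, add_zero, mul_one, if_pos rfl, add_zero, zero_mul, add_zero]
  · rw [Pi.single_eq_of_ne (Ne.symm hkf), zero_add, if_neg hkf]
    ring

/-- **Polars under the linear move**: `D_w (tsch f φ_c g) = tsch f φ_c (D_{w⁺} g)` with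
`w⁺ = update w f (w_f + Σᵢ cᵢ wᵢ)` (`c_f = 0`). [cite: Humphreys1990, § 3.10 (chain rule)] -/
theorem polarMap_tsch_linear (hc : c f = 0) (g : MvPolynomial (Fin 4) K) (w : Fin 4 → K) :
    polarMap (tsch f (∑ i, C (c i) * X i) g) w =
      tsch f (∑ i, C (c i) * X i) (polarMap g (Function.update w f (w f + ∑ i, c i * w i))) := by
  classical
  rw [NarrowApolarity.polarMap_apply, NarrowApolarity.polarMap_apply, map_sum]
  simp_rw [pderiv_tsch_linear hc, smul_add, Finset.sum_add_distrib, map_smul]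
  -- right-hand side: split `w⁺ = w + (Σ cᵢwᵢ) e_f`
  have hsplit : ∑ k, Function.update w f (w f + ∑ i, c i * w i) k • tsch f (∑ i, C (c i) * X i) (pderiv k g) =
      ∑ k, w k • tsch f (∑ i, C (c i) * X i) (pderiv k g) +
        (∑ i, c i * w i) • tsch f (∑ i, C (c i) * X i) (pderiv f g) := by
    rw [← Finset.add_sum_erase _ _ (Finset.mem_univ f), Function.update_self, add_smul,
      ← Finset.add_sum_erase _ (fun k => w k • _) (Finset.mem_univ f)]
    have hrest : ∑ k ∈ Finset.univ.erase f, Function.update w f (w f + ∑ i, c i * w i) k •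
        tsch f (∑ i, C (c i) * X i) (pderiv k g) =
        ∑ k ∈ Finset.univ.erase f, w k • tsch f (∑ i, C (c i) * X i) (pderiv k g) :=
      Finset.sum_congr rfl fun k hk => by rw [Function.update_of_ne (Finset.ne_of_mem_erase hk)]
    rw [hrest]
    ring
  rw [hsplit]
  congr 1
  -- `Σ_k w_k • (C c_k * T) = (Σ_k c_k w_k) • T`
  rw [Finset.sum_smul]
  refine Finset.sum_congr rfl fun k _ => ?_
  rw [smul_eq_C_mul, smul_eq_C_mul, ← mul_assoc, ← C_mul, mul_comm (w k) (c k)]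

/-- The linear move is injective on polynomials (`c_f = 0`). [folklore] -/
theorem tsch_linear_eq_zero_iff (hc : c f = 0) (P : MvPolynomial (Fin 4) K) :
    tsch f (∑ i, C (c i) * X i) P = 0 ↔ P = 0 := by
  refine ⟨fun h => ?_, fun h => by rw [h, map_zero]⟩
  rw [← tsch_neg_tsch (not_mem_vars_linear hc) P, h, map_zero]

/-- **Membership in the polar kernel under the linear move**: `w ∈ A(tsch f φ_c g) ↔ w⁺ ∈ A(g)`.
[folklore] -/
theorem mem_additiveSubspace_tsch_linear_iff (hc : c f = 0) (g : MvPolynomial (Fin 4) K) (w : Fin 4 → K) :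
    w ∈ additiveSubspace (tsch f (∑ i, C (c i) * X i) g) ↔
      Function.update w f (w f + ∑ i, c i * w i) ∈ additiveSubspace g := by
  unfold additiveSubspace
  rw [LinearMap.mem_ker, LinearMap.mem_ker, polarMap_tsch_linear hc, tsch_linear_eq_zero_iff hc]

/-- The vector move `w ↦ w⁺` is undone by the move with `−c` (`c_f = 0`). [folklore] -/
theorem update_neg_update (hc : c f = 0) (w : Fin 4 → K) :
    Function.update (Function.update w f (w f + ∑ i, c i * w i)) f
        ((Function.update w f (w f + ∑ i, c i * w i)) f +
          ∑ i, (-c) i * (Function.update w f (w f + ∑ i, c i * w i)) i) = w := by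
  classical
  funext k
  by_cases hkf : k = f
  · subst hkf
    rw [Function.update_self, Function.update_self]
    have hsum : ∑ i, (-c) i * Function.update w k (w k + ∑ i, c i * w i) i = -∑ i, c i * w i := by
      rw [← Finset.sum_neg_distrib]
      refine Finset.sum_congr rfl fun i _ => ?_
      by_cases hik : i = k
      · subst hik; rw [Pi.neg_apply, hc, neg_zero, zero_mul, zero_mul, neg_zero]
      · rw [Function.update_of_ne hik, Pi.neg_apply, neg_mul]
    rw [hsum]
    ring
  · rw [Function.update_of_ne hkf, Function.update_of_ne hkf]

/-- **The polar kernel keeps its dimension under the linear move** (`e_G` is frame-independent).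
[folklore] -/
theorem finrank_additiveSubspace_tsch_linear (hc : c f = 0) (g : MvPolynomial (Fin 4) K) :
    Module.finrank K (additiveSubspace (tsch f (∑ i, C (c i) * X i) g)) =
      Module.finrank K (additiveSubspace g) := by
  classical
  have hnc : (-c) f = 0 := by rw [Pi.neg_apply, hc, neg_zero]
  let L0 : (Fin 4 → K) →ₗ[K] (Fin 4 → K) :=
    { toFun := fun w => Function.update w f (w f + ∑ i, c i * w i)
      map_add' := fun x y => by
        funext k
        by_cases hkf : k = f
        · subst hkf
          simp only [Function.update_self, Pi.add_apply, mul_add, Finset.sum_add_distrib]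
          ring
        · simp only [Function.update_of_ne hkf, Pi.add_apply]
      map_smul' := fun a x => by
        funext k
        by_cases hkf : k = f
        · subst hkf
          simp only [Function.update_self, Pi.smul_apply, smul_eq_mul, RingHom.id_apply]
          rw [mul_add, Finset.mul_sum]
          refine congrArg _ (Finset.sum_congr rfl fun i _ => ?_)
          ring
        · simp only [Function.update_of_ne hkf, Pi.smul_apply, smul_eq_mul, RingHom.id_apply] }
  let L : (Fin 4 → K) ≃ₗ[K] (Fin 4 → K) :=
    { L0 with
      invFun := fun w => Function.update w f (w f + ∑ i, (-c) i * w i)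
      left_inv := fun w => update_neg_update hc w
      right_inv := fun w => by
        have h := update_neg_update hnc w
        simp only [neg_neg] at h
        exact h }
  have hcomap : additiveSubspace (tsch f (∑ i, C (c i) * X i) g) =
      (additiveSubspace g).comap (L : (Fin 4 → K) →ₗ[K] (Fin 4 → K)) := by
    ext w
    rw [Submodule.mem_comap, mem_additiveSubspace_tsch_linear_iff hc]
    rfl
  rw [hcomap, Submodule.comap_equiv_eq_map_symm]
  exact LinearEquiv.finrank_map_eq L.symm _

end Linear

/-! ## 3. State level: the vertex of the residual cone in the new frame -/

/-- **The vertex moves with the frame**: for the linear move of a free letter `f` (`c_f = 0`, `r_f = 0`,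
`x^r ∣ F`), `w ∈ Vtx(⟨tsch f φ_c s.F, s.r, s.exc⟩) ↔ w⁺ ∈ Vtx(s)`. [folklore] -/
theorem mem_resVertex_tschState_linear_iff {c : Fin 4 → K} (hc : c f = 0) {s : State K} (hr0 : s.r f = 0)
    (hr : ∀ d ∈ s.F.support, s.r ≤ d) (w : Fin 4 → K) :
    w ∈ ResCone.resVertex (⟨tsch f (∑ i, C (c i) * X i) s.F, s.r, s.exc⟩ : State K) ↔
      Function.update w f (w f + ∑ i, c i * w i) ∈ ResCone.resVertex s := by
  unfold ResCone.resVertex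
  rw [resForm_tschState_of_isHomogeneous_one (not_mem_vars_linear hc) (isHomogeneous_linear c) hr0 hr,
    mem_additiveSubspace_tsch_linear_iff hc]

/-- **`e_G` is frame-independent**: the vertex of the residual cone has the same dimension in the new
frame (linear move of a free letter, `c_f = 0`, `r_f = 0`, `x^r ∣ F`). [folklore] -/
theorem finrank_resVertex_tschState_linear {c : Fin 4 → K} (hc : c f = 0) {s : State K} (hr0 : s.r f = 0)
    (hr : ∀ d ∈ s.F.support, s.r ≤ d) :
    Module.finrank K (ResCone.resVertex (⟨tsch f (∑ i, C (c i) * X i) s.F, s.r, s.exc⟩ : State K)) =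
      Module.finrank K (ResCone.resVertex s) := by
  unfold ResCone.resVertex
  rw [resForm_tschState_of_isHomogeneous_one (not_mem_vars_linear hc) (isHomogeneous_linear c) hr0 hr]
  exact finrank_additiveSubspace_tsch_linear hc _

end FrameChange

end Summit.ResolutionOfSingularities.ResolutionOfSingularities.Theorems.PIDim4

end
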